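import Literature.AnabelianGeometry.SemiGraphs.TemperedCurveGroupLevelDataNonVacuity2
import Literature.AnabelianGeometry.SemiGraphs.ProfiniteFreeTwoProcyclicCommensurator
import HarnessLib

/-!
# [SemiAnbd] Theorem 6.5 (i), (ii), (iv) AS TYPED hold at a §6 datum with genuine arithmetic part,
# nonabelian slim `Δ` and a cusp — non-vacuity of the Thm. 6.5 package

Mochizuki, *Semi-graphs of anabelioids*, Publ. RIMS **42** (2006) [SemiAnbd], Theorem 6.5 (Tempered
Decomposition Groups) pp. 71–72: (i) "the closed point `x` is completely determined by the conjugacy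
class of `D_x`" / "by … `I_x`" for cusps; (ii) "`D_x` is commensurably terminal in `Π^temp_{X_K}`. If
`x` is a cusp, then `D_x = C_{Π^temp_{X_K}}(H)` for any open subgroup `H ⊆ I_x`"; (iv) "no noncuspidal
decomposition group … is contained in a cuspidal decomposition group". [cite: MochizukiSemiAnbd2006, Thm 6.5 pp.71-72]

PROOF-ONLY non-vacuity file (abc-iut cell, NV lane, row «GroupLevelData genuine-arith+slim-Δ+cusp»,
prover abc-iut-w5-d040; no definition).  The cell types Thm. 6.5 (i)(ii)(iv) as the predicates
`DecompDeterminesPoint`, `InertiaDeterminesCusp`, `DecompCommensurablyTerminal`,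
`DecompEqCommensuratorOfOpenInertia`, `NoncuspidalNotLeCuspidal` of `TemperedAnabelian.lean`
(abc-iut-L3-t2), bundled over a certified origin as `TemperedOrigin.TemperedDecompositionGroupsHolds`,
and CONSUMES them as named hypotheses (e.g. `hctX : DecompCommensurablyTerminal` in the Thm. 6.8 (iii) /
[Mzk8] Cor. 2.5 assemblies of abc-iut-w5-d040 gen 0).  At the previously available §6 data they are
either VACUOUS (`TemperedCurve.degenerate`: no closed points) or FALSE (`toyHyperbolic`: `D_x` is normal
of infinite index, so (ii) fails).  Here all five HOLD, non-vacuously, at the datum of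
`TemperedCurveGroupLevelDataNonVacuity2.lean` (rebuilt inside the proof): `K = ℚ_p`,
`Π^temp := G_{ℚ_p} × F̂₂`, one closed point, a cusp, `D_x = G_{ℚ_p} × îa(Ẑ)`, `I_x = 1 × îa(Ẑ)`:

* `exists_temperedCurve_thm65_package_genuine` — `∃ X : TemperedCurve p` with `X.K = ⊥`, `aug`
  surjective, `Nonempty X.GroupLevelData`, a cusp, `Δ^temp` nonabelian, `Π^temp` and `Δ^temp` slim,
  AND `DecompDeterminesPoint`, `InertiaDeterminesCusp` (one point), **`DecompCommensurablyTerminal`**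
  (`C_{G×F̂₂}(G × îa(Ẑ)) = G × îa(Ẑ)`, from `FreeTwoProcyclic.commensurator_comap_snd_eq`: `îa(Ẑ)` is
  commensurably terminal in `F̂₂` by the centraliser condition), **`DecompEqCommensuratorOfOpenInertia`**
  (an open `H ≤ I_x ≅ Ẑ` has finite index, so contains `(1, η(a)^n)`, `n > 0`, and
  `FreeTwoProcyclic.commensurator_eq_of_le_one_prod` gives `C(H) = D_x`), `NoncuspidalNotLeCuspidal`
  (no noncuspidal points — honest: vacuous), and `Thm68Sub.DecompCompact` (T68-B1: `D_x` compact).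

HONEST LIMITS as in `TemperedCurveGroupLevelDataNonVacuity2.lean`: a direct-product toy, compact
`Π^temp`, one closed point (so (i) and (iv) hold for trivial reasons; (ii) is the substantive conjunct);
Thm. 6.5 (iii) (`IsoPreservesCuspidalDecomp`) is NOT claimed (the automorphism `id × (a ↔ b)` of
`G_{ℚ_p} × F̂₂` moves `cl η⟨a⟩` off its conjugacy class); not André's `π₁^temp` of a curve.  A witness
is consistency evidence for the typed statements, not an endorsement; nothing of [SemiAnbd] is asserted;
no side is taken on [IUTchIII] Cor. 3.12.
-/

noncomputable section

open Topology Filter Set Function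
open scoped Pointwise
open Literature.IUT.HodgeTheaters (profiniteCompletion toCompletion toCompletion_int_injective)
open Literature.AlgebraicGeometry.Frobenioids (IsSlimGroup)
open Literature.AnabelianGeometry.AbsoluteAnabelian

namespace Literature.AnabelianGeometry.SemiGraphs

/-- Slimness is transported along isomorphisms of topological groups (bookkeeping; private copy).
[folklore] -/
private theorem isSlimGroup_of_continuousMulEquiv₃ {G₁ G₂ : Type*} [Group G₁] [TopologicalSpace G₁]
    [Group G₂] [TopologicalSpace G₂] (e : G₁ ≃ₜ* G₂) (h : IsSlimGroup G₁) : IsSlimGroup G₂ := by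
  refine ⟨fun H hH => ?_⟩
  refine (Subgroup.eq_bot_iff_forall _).mpr fun z hz => ?_
  have hH' : IsOpen ((H.comap e.toMulEquiv.toMonoidHom : Subgroup G₁) : Set G₁) :=
    hH.preimage e.continuous
  have hz' : e.symm z ∈ Subgroup.centralizer ((H.comap e.toMulEquiv.toMonoidHom : Subgroup G₁) : Set G₁) := by
    refine Subgroup.mem_centralizer_iff.mpr fun g hg => ?_
    have := Subgroup.mem_centralizer_iff.mp hz (e g) hg
    apply e.injective
    simpa [map_mul] using this
  rw [h.centralizer_eq_bot _ hH'] at hz'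
  have : e.symm z = 1 := Subgroup.mem_bot.mp hz'
  simpa using congrArg e this

/-- **[SemiAnbd] Thm. 6.5 (i), (ii), (iv) AS TYPED, together with `GroupLevelData`, a cusp, nonabelian
slim `Δ^temp` and `G_K = G_{ℚ_p}`, hold simultaneously at one `X : TemperedCurve p`** — the datum
`Π^temp := G_{ℚ_p} × F̂₂`, `D_x = G_{ℚ_p} × îa(Ẑ)` of `TemperedCurveGroupLevelDataNonVacuity2.lean`.  The
substantive conjuncts are (ii): `C_Π(D_x) = D_x` and `D_x = C_Π(H)` for every open `H ≤ I_x`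
(`FreeTwoProcyclic.commensurator_comap_snd_eq` / `commensurator_eq_of_le_one_prod`); (i), (iv) hold
because there is one closed point (honest).  Consistency evidence only.
[cite: MochizukiSemiAnbd2006, Thm 6.5 pp.71-72] -/
theorem exists_temperedCurve_thm65_package_genuine (p : ℕ) [Fact p.Prime] :
    ∃ X : TemperedCurve p,
      X.K = ⊥ ∧ Function.Surjective X.aug ∧ Nonempty X.GroupLevelData ∧
      (∃ x : X.Pt, X.IsCusp x) ∧
      (∃ g ∈ X.DeltaTemp, ∃ h ∈ X.DeltaTemp, g * h ≠ h * g) ∧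
      IsSlimGroup X.PiTemp ∧ IsSlimGroup X.DeltaTemp ∧
      X.DecompDeterminesPoint ∧ X.InertiaDeterminesCusp ∧ X.DecompCommensurablyTerminal ∧
      X.DecompEqCommensuratorOfOpenInertia ∧ X.NoncuspidalNotLeCuspidal ∧
      Thm68Sub.DecompCompact X := by
  classical
  -- instances on `G_{ℚ_p}`
  haveI : IsGalois ℚ_[p] (AlgebraicClosure ℚ_[p]) := {}
  haveI : T2Space (GQp p) := krullTopology_t2
  -- the profinite data (abc-iut-w5-d218's toolkit)
  let P : ProfiniteGrp.{0} := profiniteCompletion (FreeGroup (Fin 2))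
  let Zh : ProfiniteGrp.{0} := profiniteCompletion (Multiplicative ℤ)
  let η : FreeGroup (Fin 2) →* P := toCompletion (FreeGroup (Fin 2))
  let ι : Multiplicative ℤ →* Zh := toCompletion (Multiplicative ℤ)
  let a : FreeGroup (Fin 2) := FreeGroup.of 0
  let b : FreeGroup (Fin 2) := FreeGroup.of 1
  let σa : FreeGroup (Fin 2) →* Multiplicative ℤ :=
    FreeGroup.lift fun j => if j = (0 : Fin 2) then Multiplicative.ofAdd (1 : ℤ) else 1
  have hσaa : σa a = Multiplicative.ofAdd 1 := by simp [σa, a]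
  have hσab : σa b = 1 := by simp [σa, b]
  let e : P →ₜ* Zh := (ProfiniteGrp.ProfiniteCompletion.lift (GrpCat.ofHom (ι.comp σa))).hom
  let îa : Zh →ₜ* P :=
    (ProfiniteGrp.ProfiniteCompletion.lift (GrpCat.ofHom (η.comp (zpowersHom _ a)))).hom
  let îb : Zh →ₜ* P :=
    (ProfiniteGrp.ProfiniteCompletion.lift (GrpCat.ofHom (η.comp (zpowersHom _ b)))).hom
  have he : ∀ g, e (η g) = ι (σa g) := fun g => lift_hom_toCompletion Zh (ι.comp σa) g
  have hîa : ∀ k : ℤ, îa (ι (Multiplicative.ofAdd k)) = η (a ^ k) := fun k => by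
    rw [lift_hom_toCompletion P (η.comp (zpowersHom _ a))]
    simp [zpowersHom_apply]
  have hîb : ∀ k : ℤ, îb (ι (Multiplicative.ofAdd k)) = η (b ^ k) := fun k => by
    rw [lift_hom_toCompletion P (η.comp (zpowersHom _ b))]
    simp [zpowersHom_apply]
  have heîa : ∀ t, e (îa t) = t := TemperedFibreProduct.apply_apply_eq_self_of a σa hσaa e îa he hîa
  have hιinj : Function.Injective ι := toCompletion_int_injective
  -- `η a` and `η b` do not commute: else `η a ∈ C(η b) ⊆ îb(Ẑ)`, and `e` kills `îb(Ẑ)` but not `η a`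
  have hnc : η a * η b ≠ η b * η a := by
    intro hab
    have hz' : η a ∈ Subgroup.centralizer ({η (b ^ (1 : ℤ))} : Set P) := by
      rw [zpow_one]; exact Subgroup.mem_centralizer_singleton_iff.mpr hab
    obtain ⟨t, ht⟩ := TemperedFibreProduct.closure_eta_zpowers_subset_range b îb hîb
      (TemperedFibreProduct.centralizer_eta_of_zpow_subset 1 one_ne_zero hz')
    have h1 : e (η a) = ι (Multiplicative.ofAdd 1) := by rw [he, hσaa]
    have h2 : e (η a) = 1 := by
      rw [← ht]; exact TemperedFibreProduct.apply_apply_eq_one_of b σa hσab e îb he hîb t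
    rw [h1, ← map_one ι] at h2
    exact absurd (hιinj h2) (by decide)
  -- the group `Π := G_{ℚ_p} × F̂₂`, the inertia `I := îa(Ẑ)` and the decomposition group `D := G_{ℚ_p} × I`
  let I : Subgroup P := îa.toMonoidHom.range
  have hIclosed : IsClosed (I : Set P) := by
    have : (I : Set P) = Set.range îa := by ext x; simp [I]
    rw [this]; exact (isCompact_range îa.continuous).isClosed
  let D : Subgroup (GQp p × P) := I.comap (MonoidHom.snd (GQp p) P)
  have hDmem : ∀ x : GQp p × P, x ∈ D ↔ x.2 ∈ I := fun x => Iff.rfl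
  have hDclosed : IsClosed (D : Set (GQp p × P)) := by
    have : (D : Set (GQp p × P)) = Prod.snd ⁻¹' (I : Set P) := by
      ext x; exact hDmem x
    rw [this]; exact hIclosed.preimage continuous_snd
  let fstH : GQp p × P →ₜ* GQp p := ContinuousMonoidHom.fst _ _
  have hfstD : fstH '' (D : Set (GQp p × P)) = Set.univ :=
    Set.eq_univ_of_forall fun g => ⟨(g, 1), (hDmem _).2 I.one_mem, rfl⟩
  -- the inertia `D ∩ Ker(pr₁) = 1 × îa(Ẑ) ≃ₜ* Ẑ` via `ê_a` (left inverse of `îa`)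
  have hinertia : Nonempty (↥(D ⊓ fstH.toMonoidHom.ker) ≃ₜ* ZHat) := by
    refine ⟨{ toFun := fun x => e x.1.2
              invFun := fun t => ⟨(1, îa t), (hDmem _).2 ⟨t, rfl⟩, (MonoidHom.mem_ker).2 rfl⟩
              left_inv := fun x => ?_
              right_inv := fun t => heîa t
              map_mul' := fun x y => by
                change e ((x : GQp p × P) * y).2 = e (x : GQp p × P).2 * e (y : GQp p × P).2
                rw [Prod.snd_mul, map_mul]
              continuous_toFun := e.continuous.comp (continuous_snd.comp continuous_subtype_val)
              continuous_invFun := (continuous_const.prodMk îa.continuous).subtype_mk _ }⟩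
    obtain ⟨⟨g, z⟩, hgz⟩ := x
    have hg : g = 1 := (MonoidHom.mem_ker).1 (Subgroup.mem_inf.1 hgz).2
    obtain ⟨u, hu⟩ : z ∈ I := (hDmem _).1 (Subgroup.mem_inf.1 hgz).1
    apply Subtype.ext
    change ((1 : GQp p), îa (e z)) = (g, z)
    rw [hg, ← hu]
    exact Prod.ext rfl (congrArg îa (heîa u))
  -- the curve-level datum
  let X : TemperedCurve p :=
    { K := ⊥
      finiteDimensional_K := inferInstance
      PiTemp := GQp p × P
      aug := fstH
      range_aug := by
        rw [IntermediateField.fixingSubgroup_bot]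
        exact MonoidHom.range_eq_top.mpr Prod.fst_surjective
      PiHat := GQp p × P
      toHat := ContinuousMonoidHom.id _
      isProfiniteCompletion_toHat := isProfiniteCompletion_id _
      toHat_injective := Function.injective_id
      augHat := fstH
      augHat_comp := fun _ => rfl
      Pt := Unit
      IsCusp := fun _ => True
      decomp := fun _ => D
      isClosed_decomp := fun _ => hDclosed
      isOpen_aug_decomp := fun _ => by
        change IsOpen (fstH '' (D : Set (GQp p × P)))
        rw [hfstD]; exact isOpen_univ
      inertia_eq_bot := fun _ h => (h trivial).elim
      inertia_equiv_zHat := fun _ _ => hinertia }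
  -- group-level facts about `Π = G_{ℚ_p} × F̂₂`
  have hT : IsTempered (GQp p × P) := IsTempered.of_profinite
  have hslimP : IsSlimGroup P := isSlimGroup_profiniteCompletion_freeGroupTwo
  have hslimG : IsSlimGroup (GQp p) := IsSubpadicFor.isSlimGroup_absoluteGaloisGroup (AbsTopIII.IsSubpadicFor.padic p)
  have hslim : IsSlimGroup (GQp p × P) := isSlimGroup_prod_of_profinite hslimG hslimP
  haveI hscG : SecondCountableTopology (GQp p) :=
    Literature.NumberTheory.LocalFields.secondCountableTopology_galQp p
  haveI hscP : SecondCountableTopology P := secondCountableTopology_profiniteCompletion_freeGroup (Fin 2)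
  have hsc : SecondCountableTopology (GQp p × P) := inferInstance
  -- `Δ^temp = Ker(pr₁) = 1 × F̂₂ ≃ₜ* F̂₂`
  have hΔmem : ∀ x : GQp p × P, x ∈ X.DeltaTemp ↔ x.1 = 1 := fun x => MonoidHom.mem_ker
  have eΔ : ∀ (H : Subgroup (GQp p × P)), (∀ x, x ∈ H ↔ x.1 = 1) → Nonempty (P ≃ₜ* H) :=
    fun H hH =>
      ⟨{ toFun := fun z => ⟨(1, z), (hH _).2 rfl⟩
         invFun := fun y => y.1.2
         left_inv := fun z => rfl
         right_inv := fun y => by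
           apply Subtype.ext
           exact Prod.ext ((hH _).1 y.2).symm rfl
         map_mul' := fun z w => Subtype.ext (Prod.ext (by simp) rfl)
         continuous_toFun := (continuous_const.prodMk continuous_id).subtype_mk _
         continuous_invFun := continuous_snd.comp continuous_subtype_val }⟩
  have hslimΔ : IsSlimGroup X.DeltaTemp := by
    obtain ⟨eH⟩ := eΔ X.DeltaTemp hΔmem
    exact isSlimGroup_of_continuousMulEquiv₃ eH hslimP
  -- the `GroupLevelData`
  let ιG := X.galoisIdentification
  have hkermem : ∀ x : GQp p × P, x ∈ (X.augK ιG).toMonoidHom.ker ↔ x.1 = 1 := fun x => by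
    rw [TemperedCurve.ker_augK]; exact hΔmem x
  have hkerClosed : IsClosed (((X.augK ιG).toMonoidHom.ker : Subgroup (GQp p × P)) : Set (GQp p × P)) := by
    have : (((X.augK ιG).toMonoidHom.ker : Subgroup (GQp p × P)) : Set (GQp p × P)) =
        Prod.fst ⁻¹' {1} := by
      ext x; exact hkermem x
    rw [this]; exact isClosed_singleton.preimage continuous_fst
  have hslimKer : IsSlimGroup (X.augK ιG).toMonoidHom.ker := by
    obtain ⟨eH⟩ := eΔ _ hkermem
    exact isSlimGroup_of_continuousMulEquiv₃ eH hslimP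
  let d : X.GroupLevelData :=
    { galEquiv := ιG
      isTempered := hT
      isTempered_ker := hT.subgroup_of_isClosed _ hkerClosed
      isSlimGroup := hslim
      isSlimGroup_ker := hslimKer
      secondCountableTopology := hsc }
  have hg : ((1 : GQp p), η a) ∈ X.DeltaTemp := (hΔmem _).2 rfl
  have hh : ((1 : GQp p), η b) ∈ X.DeltaTemp := (hΔmem _).2 rfl
  have hgh : ((1 : GQp p), η a) * ((1 : GQp p), η b) ≠ ((1 : GQp p), η b) * ((1 : GQp p), η a) :=
    fun hc => hnc (by simpa using congrArg Prod.snd hc)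
  -- the inertia `I_x = D ∩ Δ^temp` and its compactness
  have hIxmem : ∀ y : GQp p × P, y ∈ X.inertia () ↔ y.2 ∈ I ∧ y.1 = 1 := fun y => by
    change y ∈ D ⊓ X.DeltaTemp ↔ _
    rw [Subgroup.mem_inf, hDmem, hΔmem]
  have hIxclosed : IsClosed ((X.inertia () : Subgroup (GQp p × P)) : Set (GQp p × P)) := by
    have : ((X.inertia () : Subgroup (GQp p × P)) : Set (GQp p × P)) =
        (Prod.snd ⁻¹' (I : Set P)) ∩ (Prod.fst ⁻¹' {1}) := by
      ext y; exact hIxmem y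
    rw [this]
    exact (hIclosed.preimage continuous_snd).inter (isClosed_singleton.preimage continuous_fst)
  haveI : CompactSpace (X.inertia ()) := isCompact_iff_compactSpace.mp hIxclosed.isCompact
  have haI : η a ∈ I := FreeTwoProcyclic.eta_of_zero_mem_range îa hîa
  have haIx : ((1 : GQp p), η a) ∈ X.inertia () := (hIxmem _).2 ⟨haI, rfl⟩
  -- Thm 6.5 (ii), first sentence: `C_Π(D_x) = D_x`
  have h65ii : X.DecompCommensurablyTerminal := fun _ =>
    FreeTwoProcyclic.commensurator_comap_snd_eq e îa σa hσaa he hîa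
  -- Thm 6.5 (ii), second sentence: `D_x = C_Π(H)` for every open `H ≤ I_x`
  have h65ii' : X.DecompEqCommensuratorOfOpenInertia := by
    intro x _ H hHle hHopen
    obtain ⟨⟩ := x
    have hH : ∀ y ∈ H, y.1 = 1 ∧ y.2 ∈ îa.toMonoidHom.range := fun y hy =>
      ⟨((hIxmem y).1 (hHle hy)).2, ((hIxmem y).1 (hHle hy)).1⟩
    haveI : Finite (X.inertia () ⧸ H.subgroupOf (X.inertia ())) :=
      Subgroup.quotient_finite_of_isOpen _ hHopen
    have hidx : (H.subgroupOf (X.inertia ())).index ≠ 0 :=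
      (Subgroup.finiteIndex_of_finite_quotient).index_ne_zero
    obtain ⟨n, hn0, -, hn⟩ := Subgroup.exists_pow_mem_of_index_ne_zero hidx ⟨_, haIx⟩
    rw [Subgroup.mem_subgroupOf, Subgroup.coe_pow] at hn
    have hmem : ((1 : GQp p), η a ^ n) ∈ H := by
      have : (((1 : GQp p), η a) ^ n : GQp p × P) = ((1 : GQp p), η a ^ n) := by
        rw [Prod.pow_mk, one_pow]
      rw [← this]; exact hn
    exact FreeTwoProcyclic.commensurator_eq_of_le_one_prod e îa σa hσaa he hîa H hH hn0 hmem
  refine ⟨X, rfl, Prod.fst_surjective, ⟨d⟩, ⟨(), trivial⟩, ⟨_, hg, _, hh, hgh⟩, hslim, hslimΔ,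
    fun _ _ _ => Subsingleton.elim _ _, fun _ _ _ _ => Subsingleton.elim _ _, h65ii, h65ii',
    fun _ _ hx _ => (hx trivial).elim, fun _ => hDclosed.isCompact⟩

end Literature.AnabelianGeometry.SemiGraphs

end
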